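import Mathlib.GroupTheory.Index
import Literature.AnabelianGeometry.SemiGraphs.ArithTemperedGroupOfOuterAction

/-!
# Finiteness of the translates of a finite-index subgroup under a congruence-continuous outer action of
# a compact group ([SemiAnbd] Def 5.1 (i)(a)(c)(d), Prop 5.2 (i)/(ii) p. 63)

Mochizuki, *Semi-graphs of anabelioids*, Publ. RIMS **42** (2006) 221–322, Def 5.1 (i) p. 62 (continuous
actions of the profinite `π̂₁(A)`), Prop 5.2 (i)/(ii) p. 63 ("follow from the various finiteness
assumptions in our definition of a 'continuous action'") [cite: MochizukiSemiAnbd2006, Prop 5.2 (i), p. 63].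

PROOF-ONLY (no definitions, no named facts; row T54-B-top of the producer debt T54-B,
`HOME/plan/GAP-LEDGER.md` G-w4d053-1; seat abc-iut-L3-d2).  The arithmetic tower (abc-iut-L3-d4,
T54-B-tower, binder `hfin` of its E1 step) needs: "every open subgroup of finite index `N ≤ π₁^temp(𝒢)`
has only FINITELY MANY translates `α(N)` under the representatives `α` of the outer action
`ρ : Π_A → Out(π₁^temp 𝒢)`" — so that E-cores of finite Galois levels are finite intersections.  This
file proves it from the SAME hypothesis schema to which `ArithLevelKerCongruence.lean` reduces the
topology binder `hK1′` — CONGRUENCE-CONTINUITY of `ρ` ("every `a` near `1` in `Π_A` has a representative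
`α ≡ id (mod N)`", the group-theoretic content of Def 5.1 (i)(c)) — together with compactness of `Π_A`
(Def 5.1 (i): `π̂₁(A)` profinite):

* `map_eq_self_of_forall_mul_inv_mem` — an automorphism congruent to the identity modulo `N` maps `N`
  onto itself;
* `finite_conjugates_of_finiteIndex` — a finite-index subgroup has finitely many conjugates;
* **`finite_translates_of_congruent_reps`** — for `Π_A` compact and `ρ : Π_A → Out(Π)` congruence-
  continuous at the finite-index `N`, the set `{α(N) | α a representative of some ρ a}` is finite
  (finitely many cosets `aᵢV` cover `Π_A`; on `aᵢV` every representative is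
  `conj g ∘ αᵢ ∘ β` with `β(N) = N`, so `α(N)` is a conjugate of `αᵢ(N)`).

Nothing here refers to the IUT corpus; no side is taken on [IUTchIII] Cor 3.12; typed ≠ proved.
-/

namespace Literature.AnabelianGeometry.SemiGraphs

namespace TemperedExtension

open Literature.AnabelianGeometry.EtaleTheta Topology Filter
open scoped Pointwise

universe u w

section Algebra

variable {G : Type u} [Group G]

/-- **An automorphism congruent to the identity modulo `N` stabilises `N`**: if `β y · y⁻¹ ∈ N` for all
`y` then `β(N) = N` (no normality needed: `β n = (β n · n⁻¹) n`, and `β⁻¹` is congruent too).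
[cite: MochizukiSemiAnbd2006, Prop 5.2 (i), p. 63] -/
theorem map_eq_self_of_forall_mul_inv_mem (N : Subgroup G) (β : MulAut G)
    (hβ : ∀ y : G, β y * y⁻¹ ∈ N) : N.map β.toMonoidHom = N := by
  ext x
  constructor
  · rintro ⟨n, hn, rfl⟩
    have : β n = (β n * n⁻¹) * n := by group
    rw [MulEquiv.coe_toMonoidHom, this]
    exact N.mul_mem (hβ n) hn
  · intro hx
    refine ⟨β.symm x, ?_, by simp⟩
    -- `β⁻¹ x = (β (β⁻¹ x) · (β⁻¹ x)⁻¹)⁻¹ · x` with the bracket in `N`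
    have h1 : β (β.symm x) * (β.symm x)⁻¹ ∈ N := hβ (β.symm x)
    rw [MulEquiv.apply_symm_apply] at h1
    have : β.symm x = (x * (β.symm x)⁻¹)⁻¹ * x := by group
    rw [this]
    exact N.mul_mem (N.inv_mem h1) hx

/-- Conjugating a subgroup by one of its own elements does nothing. [folklore] -/
private theorem map_conj_eq_self_of_mem (H : Subgroup G) {h : G} (hh : h ∈ H) :
    H.map (MulAut.conj h).toMonoidHom = H := by
  ext x
  constructor
  · rintro ⟨y, hy, rfl⟩
    exact H.mul_mem (H.mul_mem hh hy) (H.inv_mem hh)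
  · intro hx
    exact ⟨h⁻¹ * x * h, H.mul_mem (H.mul_mem (H.inv_mem hh) hx) hh, by simp [mul_assoc]⟩

/-- Conjugation by a product, at the level of monoid homomorphisms. [folklore] -/
private theorem conj_mul_toMonoidHom (g h : G) :
    (MulAut.conj (g * h)).toMonoidHom =
      (MulAut.conj g).toMonoidHom.comp (MulAut.conj h).toMonoidHom := by
  ext x
  simp [MulAut.conj_apply, mul_assoc]

/-- **A subgroup of finite index has finitely many conjugates.** [cite: MochizukiSemiAnbd2006, Prop 5.2 (i), p. 63] -/
theorem finite_conjugates_of_finiteIndex (H : Subgroup G) [H.FiniteIndex] :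
    Set.Finite (Set.range fun g : G => H.map (MulAut.conj g).toMonoidHom) := by
  classical
  haveI : Finite (G ⧸ H) := Subgroup.finite_quotient_of_finiteIndex
  refine (Set.finite_range fun q : G ⧸ H => H.map (MulAut.conj q.out).toMonoidHom).subset ?_
  rintro _ ⟨g, rfl⟩
  refine ⟨(g : G ⧸ H), ?_⟩
  obtain ⟨h, hh⟩ := QuotientGroup.mk_out_eq_mul H g
  change H.map (MulAut.conj (QuotientGroup.mk g : G ⧸ H).out).toMonoidHom = _
  rw [hh, conj_mul_toMonoidHom, ← Subgroup.map_map, map_conj_eq_self_of_mem H h.2]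

/-- Conjugates of the image of `N` under an automorphism are images of conjugates of `N`:
`g · α(N) · g⁻¹ = α(α⁻¹(g) · N · α⁻¹(g)⁻¹)`. [folklore] -/
private theorem map_conj_map_eq (N : Subgroup G) (α : MulAut G) (g : G) :
    (N.map α.toMonoidHom).map (MulAut.conj g).toMonoidHom =
      (N.map (MulAut.conj (α.symm g)).toMonoidHom).map α.toMonoidHom := by
  rw [Subgroup.map_map, Subgroup.map_map]
  congr 1
  ext x
  simp [MulAut.conj_apply]

end Algebra

/-! ### Finiteness of translates under a congruence-continuous outer action of a compact group -/

section Translates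

variable {G : Type u} [Group G] [TopologicalSpace G]
  {PA : Type w} [Group PA] [TopologicalSpace PA] [IsTopologicalGroup PA] [CompactSpace PA]
  (ρ : PA →* TopOut G)

/-- **Finitely many translates** ([SemiAnbd] Prop 5.2 (i)/(ii) "follow from the various finiteness
assumptions"): for `Π_A` compact, `ρ : Π_A → Out(Π)` and a finite-index subgroup `N ≤ Π` at which `ρ`
is CONGRUENCE-CONTINUOUS (every `u` in some neighbourhood of `1` has a representative `β` with
`β y · y⁻¹ ∈ N` for all `y`), the subgroups `α(N)`, `α` ranging over the representatives of all `ρ a`,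
form a FINITE set. [cite: MochizukiSemiAnbd2006, Prop 5.2 (i), p. 63] -/
theorem finite_translates_of_congruent_reps (N : Subgroup G) [N.FiniteIndex]
    (hCC : ∃ U ∈ 𝓝 (1 : PA), ∀ u ∈ U, ∃ β : contMulAut G,
      TopOut.mk G β = ρ u ∧ ∀ y : G, (β : MulAut G) y * y⁻¹ ∈ N) :
    Set.Finite {M : Subgroup G | ∃ (a : PA) (α : contMulAut G),
      TopOut.mk G α = ρ a ∧ M = N.map (α : MulAut G).toMonoidHom} := by
  classical
  obtain ⟨U, hU, hCC⟩ := hCC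
  -- finitely many translates `aᵢ • interior U` cover the compact `Π_A`
  let V : Set PA := interior U
  have hV : IsOpen V := isOpen_interior
  have h1V : (1 : PA) ∈ V := mem_interior_iff_mem_nhds.mpr hU
  obtain ⟨t, ht⟩ := isCompact_univ.elim_finite_subcover (fun a : PA => (fun x => a * x) '' V)
    (fun a => (Homeomorph.mulLeft a).isOpenMap _ hV)
    (fun a _ => Set.mem_iUnion.mpr ⟨a, ⟨1, h1V, mul_one a⟩⟩)
  -- a representative `αᵢ` of each `ρ aᵢ`
  have hrep : ∀ a : PA, ∃ α : contMulAut G, TopOut.mk G α = ρ a := fun a =>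
    QuotientGroup.mk'_surjective _ (ρ a)
  choose rep hrep using hrep
  -- the finite candidate set: images under the `αᵢ` of the conjugates of `N`
  let F : Set (Subgroup G) := ⋃ a ∈ t, (fun M : Subgroup G => M.map (rep a : MulAut G).toMonoidHom) ''
    Set.range (fun g : G => N.map (MulAut.conj g).toMonoidHom)
  have hF : F.Finite := by
    refine Set.Finite.biUnion t.finite_toSet fun a _ => ?_
    exact (finite_conjugates_of_finiteIndex N).image _
  refine hF.subset ?_
  rintro _ ⟨a, α, hα, rfl⟩
  -- `a = aᵢ * v` with `v ∈ V ⊆ U`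
  obtain ⟨i, hi, ⟨v, hv, hav⟩⟩ : ∃ i ∈ t, a ∈ (fun x => i * x) '' V := by
    simpa only [Set.mem_iUnion, exists_prop] using ht (Set.mem_univ a)
  obtain ⟨β, hβ, hβN⟩ := hCC v (interior_subset hv)
  -- `α` and `αᵢ β` represent the same outer class, so `α = conj g ∘ αᵢ ∘ β`
  have hav' : i * v = a := hav
  have hclass : TopOut.mk G (rep i * β) = TopOut.mk G α := by
    rw [map_mul, hrep, hβ, ← map_mul, hav', hα]
  obtain ⟨g, hg⟩ := exists_conj_of_mk_eq (rep i * β) α hclass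
  have hαeq : (α : MulAut G).toMonoidHom =
      (MulAut.conj g).toMonoidHom.comp
        (((rep i : contMulAut G) : MulAut G).toMonoidHom.comp ((β : MulAut G).toMonoidHom)) := by
    ext x
    simp only [MulEquiv.coe_toMonoidHom, MonoidHom.coe_comp, Function.comp_apply, MulAut.conj_apply]
    rw [hg x]
    rfl
  refine Set.mem_iUnion₂.mpr ⟨i, hi, ?_⟩
  refine ⟨N.map (MulAut.conj (((rep i : contMulAut G) : MulAut G).symm g)).toMonoidHom, ⟨_, rfl⟩, ?_⟩
  rw [hαeq, ← Subgroup.map_map, ← Subgroup.map_map,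
    map_eq_self_of_forall_mul_inv_mem N (β : MulAut G) hβN, map_conj_map_eq]

end Translates
end TemperedExtension

end Literature.AnabelianGeometry.SemiGraphs
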